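import Mathlib

/-!
# A Gaussian weight sum on the discrete torus `(ℤ/Sℤ)⁴`

Helper file for item stmt-QuantumFields-14707 (`FlowLineStateSpace.EntropyNonConcentrationFromUI`,
route FlowLineStateSpace, YangMills sub-problem). For the Gaussian weights of the lattice entropy
functional `Φ^{lat}_{(x,s)}(R) = Σ_y exp(-d(x,y)²/(4R²t₀)) e_k(…, y)`, with `d` the torus distance
`d(x,y)² = Σ_i min(|x_i - y_i|, S - |x_i - y_i|)²`, we prove the elementary bound

  `Σ_{y ∈ (ℤ/Sℤ)⁴} exp(-d(x,y)²/(4σ²)) ≤ (2 (1 + √(π σ²)))⁴`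

(`gaussSum_torus_le`): the weight factorises over the four coordinates, each coordinate sum is at
most `Σ_{j ≥ 0} e^{-j²/4σ²} + Σ_{j ≥ 1} e^{-j²/4σ²} ≤ 1 + 2 ∫_0^∞ e^{-u²/4σ²} du = 1 + 2√(πσ²)` (sum vs.
integral for the decreasing Gaussian, Mathlib's `integral_gaussian_Ioi`), and the consequence
`≤ 16 (1 + √π)⁴ σ⁴` for `σ² ≥ 1` (`gaussSum_torus_le_of_one_le`). Pure real analysis; no statement
about Yang–Mills is proved here.
-/

noncomputable section

open Real Finset MeasureTheory Set

namespace Summit.QuantumFields.YangMills.Theorems.FlowLineStateSpaceEntropy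

/-! ### One coordinate -/

/-- The Gaussian `j ↦ exp(-j²/(4σ²))` summed over `1 ≤ j ≤ n` is at most `√(π σ²)`. -/
theorem sum_Icc_exp_neg_sq_le {σ2 : ℝ} (hσ : 0 < σ2) (n : ℕ) :
    ∑ j ∈ Finset.range n, Real.exp (-((j + 1 : ℕ) : ℝ) ^ 2 / (4 * σ2)) ≤ Real.sqrt (π * σ2) := by
  set f : ℝ → ℝ := fun u => Real.exp (-(1 / (4 * σ2)) * u ^ 2) with hf
  have hanti : AntitoneOn f (Icc (0 : ℝ) n) := by
    intro u hu v hv huv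
    simp only [hf]
    apply Real.exp_le_exp.mpr
    have : u ^ 2 ≤ v ^ 2 := by
      have hu0 : 0 ≤ u := hu.1
      nlinarith
    have hc : 0 < 1 / (4 * σ2) := by positivity
    nlinarith
  have h1 := AntitoneOn.sum_le_integral_Ico (Nat.zero_le n) (by simpa using hanti)
  simp only [Nat.Ico_zero_eq_range, Nat.cast_zero] at h1
  have h2 : ∫ x in (0 : ℝ)..n, f x ≤ ∫ x in Ioi (0 : ℝ), f x := by
    rw [intervalIntegral.integral_of_le (by positivity)]
    refine setIntegral_mono_set ?_ ?_ ?_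
    · exact (integrable_exp_neg_mul_sq (by positivity)).integrableOn
    · exact Filter.Eventually.of_forall fun x => (Real.exp_pos _).le
    · exact Filter.Eventually.of_forall (fun x hx => show x ∈ Ioi (0:ℝ) from hx.1)
  have h3 : ∫ x in Ioi (0 : ℝ), f x = Real.sqrt (π * σ2) := by
    simp only [hf]
    rw [integral_gaussian_Ioi]
    rw [show π / (1 / (4 * σ2)) = (2 : ℝ) ^ 2 * (π * σ2) by field_simp; ring,
      Real.sqrt_mul (by positivity), Real.sqrt_sq (by norm_num)]
    ring
  calc ∑ j ∈ Finset.range n, Real.exp (-((j + 1 : ℕ) : ℝ) ^ 2 / (4 * σ2))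
      = ∑ j ∈ Finset.range n, f ((j + 1 : ℕ) : ℝ) := by
        refine sum_congr rfl fun j _ => ?_
        simp only [hf]; congr 1; ring
    _ ≤ ∫ x in (0 : ℝ)..n, f x := h1
    _ ≤ Real.sqrt (π * σ2) := h2.trans h3.le

/-- One coordinate of the torus: for `a ∈ ℤ/(n+1)ℤ`,
`Σ_m exp(-min(|a-m|, n+1-|a-m|)²/(4σ²)) ≤ 2 (1 + √(πσ²))`. -/
theorem coord_sum_le {σ2 : ℝ} (hσ : 0 < σ2) (n : ℕ) (a : ZMod (n + 1)) :
    ∑ m : ZMod (n + 1),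
        Real.exp (-((min (a - m).val (n + 1 - (a - m).val) : ℕ) : ℝ) ^ 2 / (4 * σ2)) ≤
      2 * (1 + Real.sqrt (π * σ2)) := by
  -- reindex `m ↦ a - m`
  have hre : ∑ m : ZMod (n + 1),
        Real.exp (-((min (a - m).val (n + 1 - (a - m).val) : ℕ) : ℝ) ^ 2 / (4 * σ2)) =
      ∑ m : ZMod (n + 1), Real.exp (-((min m.val (n + 1 - m.val) : ℕ) : ℝ) ^ 2 / (4 * σ2)) :=
    Fintype.sum_equiv (Equiv.subLeft a) _ _ fun m => rfl
  rw [hre]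
  set g : ℕ → ℝ := fun v => Real.exp (-(v : ℝ) ^ 2 / (4 * σ2)) with hg
  have hg0 : ∀ v, 0 ≤ g v := fun v => (Real.exp_pos _).le
  -- `g (min u v) ≤ g u + g v`
  have hmin : ∀ u v : ℕ, g (min u v) ≤ g u + g v := by
    intro u v
    rcases le_total u v with h | h
    · rw [min_eq_left h]; linarith [hg0 v]
    · rw [min_eq_right h]; linarith [hg0 u]
  have hsplit : ∑ m : ZMod (n + 1), g (min m.val (n + 1 - m.val)) ≤
      ∑ m : ZMod (n + 1), g m.val + ∑ m : ZMod (n + 1), g (n + 1 - m.val) := by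
    rw [← sum_add_distrib]
    exact sum_le_sum fun m _ => hmin _ _
  -- the two sums over `ZMod (n+1) = Fin (n+1)`
  have hval : ∑ m : ZMod (n + 1), g m.val = ∑ j ∈ Finset.range (n + 1), g j :=
    Fin.sum_univ_eq_sum_range (fun j => g j) (n + 1)
  have hval' : ∑ m : ZMod (n + 1), g (n + 1 - m.val) = ∑ j ∈ Finset.range (n + 1), g (n + 1 - j) :=
    Fin.sum_univ_eq_sum_range (fun j => g (n + 1 - j)) (n + 1)
  have hA : ∑ j ∈ Finset.range (n + 1), g j ≤ 1 + Real.sqrt (π * σ2) := by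
    rw [Finset.sum_range_succ']
    have h0 : g 0 = 1 := by simp [hg]
    rw [h0]
    have := sum_Icc_exp_neg_sq_le hσ n
    simp only [hg]
    linarith
  have hB : ∑ j ∈ Finset.range (n + 1), g (n + 1 - j) ≤ Real.sqrt (π * σ2) := by
    rw [← Finset.sum_range_reflect]
    have : ∑ j ∈ Finset.range (n + 1), g (n + 1 - (n + 1 - 1 - j)) =
        ∑ j ∈ Finset.range (n + 1), g (j + 1) := by
      refine sum_congr rfl fun j hj => ?_
      rw [Finset.mem_range] at hj
      congr 1; omega
    rw [this]
    have := sum_Icc_exp_neg_sq_le hσ (n + 1)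
    simpa [hg] using this
  calc ∑ m : ZMod (n + 1), g (min m.val (n + 1 - m.val))
      ≤ ∑ m : ZMod (n + 1), g m.val + ∑ m : ZMod (n + 1), g (n + 1 - m.val) := hsplit
    _ ≤ (1 + Real.sqrt (π * σ2)) + Real.sqrt (π * σ2) := by rw [hval, hval']; exact add_le_add hA hB
    _ ≤ 2 * (1 + Real.sqrt (π * σ2)) := by linarith [Real.sqrt_nonneg (π * σ2)]

/-! ### The torus sum -/

/-- **Gaussian weight sum on the torus.** For `x : (ℤ/(n+1)ℤ)⁴` and `σ² > 0`:
`Σ_y exp(-Σ_i min(|x_i-y_i|, n+1-|x_i-y_i|)²/(4σ²)) ≤ (2(1+√(πσ²)))⁴`. -/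
theorem gaussSum_torus_le {σ2 : ℝ} (hσ : 0 < σ2) (n : ℕ) (x : Fin 4 → ZMod (n + 1)) :
    ∑ y : Fin 4 → ZMod (n + 1),
        Real.exp (-(∑ i : Fin 4, ((min (x i - y i).val (n + 1 - (x i - y i).val) : ℕ) : ℝ) ^ 2) /
          (4 * σ2)) ≤ (2 * (1 + Real.sqrt (π * σ2))) ^ 4 := by
  -- factorise the weight
  have hfac : ∀ y : Fin 4 → ZMod (n + 1),
      Real.exp (-(∑ i : Fin 4, ((min (x i - y i).val (n + 1 - (x i - y i).val) : ℕ) : ℝ) ^ 2) /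
          (4 * σ2)) =
        ∏ i : Fin 4, Real.exp (-((min (x i - y i).val (n + 1 - (x i - y i).val) : ℕ) : ℝ) ^ 2 /
          (4 * σ2)) := by
    intro y
    rw [← Real.exp_sum]
    congr 1
    rw [← sum_neg_distrib, sum_div]
  simp_rw [hfac]
  -- sum over the product type = product of the coordinate sums
  have hprod := Finset.sum_prod_piFinset (Finset.univ : Finset (ZMod (n + 1)))
    (fun (i : Fin 4) (m : ZMod (n + 1)) =>
      Real.exp (-((min (x i - m).val (n + 1 - (x i - m).val) : ℕ) : ℝ) ^ 2 / (4 * σ2)))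
  rw [Fintype.piFinset_univ] at hprod
  rw [hprod]
  calc ∏ i : Fin 4, ∑ m : ZMod (n + 1),
        Real.exp (-((min (x i - m).val (n + 1 - (x i - m).val) : ℕ) : ℝ) ^ 2 / (4 * σ2))
      ≤ ∏ _i : Fin 4, (2 * (1 + Real.sqrt (π * σ2))) := by
        refine prod_le_prod (fun i _ => sum_nonneg fun m _ => (Real.exp_pos _).le) fun i _ => ?_
        exact coord_sum_le hσ n (x i)
    _ = (2 * (1 + Real.sqrt (π * σ2))) ^ 4 := by simp

/-- The same bound in the form used downstream: for `σ² ≥ 1`,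
`Σ_y exp(-d(x,y)²/(4σ²)) ≤ 16 (1 + √π)⁴ (σ²)²`. -/
theorem gaussSum_torus_le_of_one_le {σ2 : ℝ} (hσ : 1 ≤ σ2) (n : ℕ) (x : Fin 4 → ZMod (n + 1)) :
    ∑ y : Fin 4 → ZMod (n + 1),
        Real.exp (-(∑ i : Fin 4, ((min (x i - y i).val (n + 1 - (x i - y i).val) : ℕ) : ℝ) ^ 2) /
          (4 * σ2)) ≤ 16 * (1 + Real.sqrt π) ^ 4 * σ2 ^ 2 := by
  have hσ0 : 0 < σ2 := by linarith
  refine (gaussSum_torus_le hσ0 n x).trans ?_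
  have hs1 : 1 ≤ Real.sqrt σ2 := by
    rw [show (1 : ℝ) = Real.sqrt 1 by simp]; exact Real.sqrt_le_sqrt hσ
  have hkey : 1 + Real.sqrt (π * σ2) ≤ (1 + Real.sqrt π) * Real.sqrt σ2 := by
    rw [Real.sqrt_mul Real.pi_pos.le]
    nlinarith [Real.sqrt_nonneg π]
  have h0 : 0 ≤ 1 + Real.sqrt (π * σ2) := by positivity
  calc (2 * (1 + Real.sqrt (π * σ2))) ^ 4 = 16 * (1 + Real.sqrt (π * σ2)) ^ 4 := by ring
    _ ≤ 16 * ((1 + Real.sqrt π) * Real.sqrt σ2) ^ 4 := by gcongr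
    _ = 16 * (1 + Real.sqrt π) ^ 4 * (Real.sqrt σ2 ^ 2) ^ 2 := by ring
    _ = 16 * (1 + Real.sqrt π) ^ 4 * σ2 ^ 2 := by rw [Real.sq_sqrt hσ0.le]

end Summit.QuantumFields.YangMills.Theorems.FlowLineStateSpaceEntropy

end
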